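import Mathlib
import Summits.QuantumFields.QCD.Theses.PauliWegnerSea
import Summits.QuantumFields.QCD.Theses.WilsonMobilityGap
import Summits.QuantumFields.QCD.Theorems.PauliWegnerSeaPhaseQuenchedFlavourDecayStubSplitBound
import Summits.QuantumFields.QCD.Theorems.PauliWegnerSeaPhaseQuenchedFlavourDecayStubCrossingLaplace
import Summits.QuantumFields.QCD.Theorems.PauliWegnerSeaPhaseQuenchedFlavourDecayStubTwoPoint
import Summits.QuantumFields.QCD.Theorems.PauliWegnerSeaPhaseQuenchedFlavourDecayStubDecayTransfer
import Summits.QuantumFields.QCD.Theorems.PauliWegnerSeaPhaseQuenchedFlavourDecayStubWickExpansion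
import Summits.QuantumFields.QCD.Theorems.PauliWegnerSeaPhaseQuenchedFlavourDecayStubWickSum
import Summits.QuantumFields.QCD.Theorems.PauliWegnerSeaPhaseQuenchedFlavourDecayStubAprioriHeavy
import Summits.QuantumFields.QCD.Theorems.PauliWegnerSeaPhaseQuenchedFlavourDecayStubGramInequality
import Summits.QuantumFields.QCD.Theorems.PauliWegnerSeaPhaseQuenchedFlavourDecayStubGramTransfer

/-!
# Crux `PhaseQuenchedFlavourDecay` (stmt-QuantumFields-9151) REDUCED to its a-priori core — the sorry-free
# composition of line `crossing-split-integrability` as tree theorems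

Crux: `Summit.QuantumFields.QCD.Theses.PauliWegnerSea.PhaseQuenchedFlavourDecay` (byte-identical to
`Summit.QuantumFields.QCD.Theses.WilsonMobilityGap.PhaseQuenchedFlavourDecay`), literally
`∀ N_f reg m > 0, UPPER(reg, m) → CONC(reg, m)` (UPPER = clause (ii) of `MobilityGap`: phase-quenched `s < 1`
fractional-moment decay of the colour–spin block of `G_f = D⁻¹` at rate `δ a_k`, volume-uniform; CONC = ONE rate
`δ' > 0` of exponential decay of `‖⟨ ⟨A(0)B(n e₀)⟩_F ⟩₊‖` for every flavour-charged gauge-invariant local `A` and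
every `B`).

The line `crossing-split-integrability` (crux workfile `Cruxes/PhaseQuenchedFlavourDecay/Lines/…`, leads 0, gen 1,
c1, c2) landed NINE registered stubs as theorems of this directory (`…StubSplitBound` p81481, `…StubCrossingLaplace`
p80134, `…StubTwoPoint` p79377, `…StubDecayTransfer` p84173, `…StubWickExpansion` p82896, `…StubWickSum` p87098,
`…StubAprioriHeavy` p96338, `…StubGramInequality` p98215, `…StubGramTransfer` p99869).  This file records their
KERNEL-CHECKED COMPOSITION as importable theorems, so that the crux is closed by modus ponens the moment its one
open input — the a-priori moment bound, handed back to the planners as crux-sized — is proved: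

* `conc_of_upper_of_minorMoments'` — trajectory-wise: for every `(N_f, reg, m)`, UPPER and `MinorMoments`
  (ONE `ε > 0` and, for every minor size `r`, an eventual volume-uniform bound on the phase-quenched
  `(1+ε)`-moments of all `r × r` Wick minors `det[(D⁻¹)(I a, J b)]`) give CONC (Wick in determinant form,
  crossing split below the integrability edge, generalised Laplace expansion by crossing matchings, torus
  translation, phase-quenched summation — all landed);
* `minorMoments_of_gramMoments'` — `GramMoments → MinorMoments` with `ε = 2q − 1` (Cauchy–Binet Gram
  inequality + measure-theoretic transfer, both landed), where `GramMoments` asks ONE `q > ½` and, for every `r`,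
  a volume- and `k`-uniform bound on the phase-quenched `q`-th moments of the PRINCIPAL minors
  `Re det((G Gᴴ)[I,I])` of the inverse fermion Gram matrix `G Gᴴ = (Dᴴ D)⁻¹`;
* `conc_of_upper_of_gramMoments'` — trajectory-wise UPPER ∧ GramMoments → CONC;
* `phaseQuenchedFlavourDecay_of_aprioriMinorMoments`, `phaseQuenchedFlavourDecay_of_aprioriGramMoments` — the
  crux BY NAME from the single open statement `AprioriMinorMoments := ∀ N_f reg m > 0, UPPER → MinorMoments`
  resp. `AprioriGramMoments := ∀ N_f reg m > 0, UPPER → GramMoments` (stated INLINE as the hypothesis, tree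
  vocabulary only — these are the registered stub signatures `stub_apriori` / `stub_gramMomentsCore`);
* `wmgPhaseQuenchedFlavourDecay_of_aprioriMinorMoments`, `wmgPhaseQuenchedFlavourDecay_of_aprioriGramMoments` —
  the same for the sibling route's copy.

Known corners of the open input (landed): heavy trajectories (all bare masses eventually `≥ m₀ > 0`,
`stub_aprioriHeavy`) and `N_f = 0` (vacuous).  Why the input is crux-sized (leads 0–c2, refuter notes W1/W2 in the
crux workfiles): it is the `r`-level phase-quenched Wegner–Minami anti-concentration for the singular values of the
Wilson–Dirac matrix under `|∏_f det D_f| · μ_W`, uniform in the volume AND along the bare trajectory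
`m_f(k) → m_crit(k)`; UPPER (fractional-moment localisation) cannot supply its integrability exponent, and the
uniform one-star cofactor domination that would localise it to a fibre is false (aligned nilpotent corner).

No definitions are introduced (pure proof file; every statement is inlined in tree vocabulary).
-/

noncomputable section

namespace Summit.QuantumFields.QCD.Cruxes.PhaseQuenchedFlavourDecay.CrossingSplitIntegrability

open scoped BigOperators
open MeasureTheory Filter
open Literature.MathematicalPhysics.QuantumFieldTheory Literature.MathematicalPhysics.QuantumLattice
  Literature.Probability.LatticeModels

/-- **UPPER ∧ MinorMoments → CONC, trajectory-wise.**  For every `(N_f, reg, m)`: the crux's hypothesis UPPER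
(verbatim) and the a-priori bound `MinorMoments` (one `ε > 0`; for every `r` an eventual, volume-uniform bound on the
phase-quenched `(1+ε)`-moments of all `r × r` Wick minors of `D⁻¹`, with their `qcdLatticeMeasure`-integrability) imply the
crux's conclusion CONC (verbatim).  Composition of the landed stubs: `stub_twoPoint` (UPPER transported to every base
site), `stub_decayTransfer` fed with `stub_splitBound` and `stub_crossingLaplace` (charged minors decay at ONE rate
`δ' = δ·min((1−s/2)ε/(1+ε), ε/(2+4ε))`), `stub_wickExpansion` (configuration-wise Wick bound of the Berezin ratio by a
fixed finite family of A-charged two-box minors) and `stub_wickSum` (phase-quenched summation). -/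
theorem conc_of_upper_of_minorMoments' (Nf : ℕ) (reg : QCDRegularisation Nf) (m : Fin Nf → ℝ)
    (hU : ∃ s δ C : ℝ, 0 < s ∧ s < 1 ∧ 0 < δ ∧ ∀ᶠ k in atTop, ∀ S : ℕ, reg.L k ≤ S → ∀ (f : Fin Nf) (v : Literature.Probability.LatticeModels.Site 4), v ∈ box 4 S → (∫ U : GaugeConfig 4 (2 * S + 1) (Matrix.specialUnitaryGroup (Fin 3) ℂ), ‖(diracMatrix U fun fl => reg.mcrit k + reg.a k * m fl / reg.Zm k).det‖ * (∑ a : Fin 3, ∑ i : Fin 4, ∑ b : Fin 3, ∑ j : Fin 4, ‖(diracMatrix U fun fl => reg.mcrit k + reg.a k * m fl / reg.Zm k)⁻¹ (quarkEquiv (f, (Torus.proj (2 * S + 1) 0, a, i))) (quarkEquiv (f, (Torus.proj (2 * S + 1) (v), b, j)))‖) ^ s ∂(wilsonMeasure (fundamentalRep (Fin 3)) (reg.β k))) / (∫ U : GaugeConfig 4 (2 * S + 1) (Matrix.specialUnitaryGroup (Fin 3) ℂ), ‖(diracMatrix U fun fl => reg.mcrit k + reg.a k * m fl / reg.Zm k).det‖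 ∂(wilsonMeasure (fundamentalRep (Fin 3)) (reg.β k))) ≤ C * Real.exp (-(δ * (reg.a k * ‖v‖))))
    (hM : ∃ ε : ℝ, 0 < ε ∧ ∀ r : ℕ, ∃ C : ℝ, ∀ᶠ k in atTop, ∀ S : ℕ, reg.L k ≤ S →
        ∀ I J : Fin r → QuarkVar Nf (2 * S + 1),
        Integrable (fun U : GaugeConfig 4 (2 * S + 1) SU3 =>
        ‖(Matrix.of fun a b : Fin r => (diracMatrix U fun fl => reg.mcrit k + reg.a k * m fl / reg.Zm k)⁻¹
        (quarkEquiv (I a)) (quarkEquiv (J b))).det‖ ^ (1 + ε))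
        (qcdLatticeMeasure (2 * S + 1) (reg.β k) fun fl => reg.mcrit k + reg.a k * m fl / reg.Zm k) ∧
        qcdPhaseQuenchedExpect (reg.β k) (2 * S + 1) (fun fl => reg.mcrit k + reg.a k * m fl / reg.Zm k)
        (fun U : GaugeConfig 4 (2 * S + 1) SU3 =>
        ‖(Matrix.of fun a b : Fin r => (diracMatrix U fun fl => reg.mcrit k + reg.a k * m fl / reg.Zm k)⁻¹
        (quarkEquiv (I a)) (quarkEquiv (J b))).det‖ ^ (1 + ε)) ≤ C) :
    ∃ δ' : ℝ, 0 < δ' ∧ ∀ (R R' : ℕ) (A : QCDLatticeObservable Nf R) (B : QCDLatticeObservable Nf R'), (∃ (f₀ : Fin Nf) (q : ℤ), q ≠ 0 ∧ ∀ (θ : ℝ) (U : LGConfig 4 (Matrix.specialUnitaryGroup (Fin 3) ℂ)), ExteriorAlgebra.map (LinearMap.pi fun w => (Sum.elim (fun i => if (boxQuarkEquiv.symm i).1 = f₀ then Complex.exp (-((θ : ℂ) * Complex.I)) else 1) (fun i => if (boxQuarkEquiv.symm i).1 = f₀ then Complex.exp ((θ : ℂ) * Complex.I) else 1) (ofLex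 w)) • LinearMap.proj w) (A.F U) = Complex.exp (((q : ℝ) * θ : ℝ) * Complex.I) • A.F U) → ∃ C' : ℝ, ∀ᶠ k in atTop, ∀ S : ℕ, reg.L k ≤ S → ∀ n : ℕ, n ≤ S → ‖(∫ U : GaugeConfig 4 (2 * S + 1) (Matrix.specialUnitaryGroup (Fin 3) ℂ), (‖(diracMatrix U fun fl => reg.mcrit k + reg.a k * m fl / reg.Zm k).det‖ : ℂ) * (fermiIntegral (A.onTorus (2 * S + 1) 0 U * B.onTorus (2 * S + 1) (Pi.single 0 (n : ℤ)) U * fermiBoltzmann U fun fl => reg.mcrit k + reg.a k * m fl / reg.Zm k) / fermiIntegral (fermiBoltzmann U fun fl => reg.mcrit k + reg.a k * m fl / reg.Zm k)) ∂(wilsonMeasure (fundamentalRep (Fin 3)) (reg.β k))) / (∫ U : GaugeConfig 4 (2 * S + 1) (Matrix.specialUnitaryGroup (Fin 3) ℂ), (‖(diracMatrix U fun fl => reg.mcrit k + reg.a k * m fl / reg.Zm k).det‖ : ℂ) ∂(wilsonMeasure (fundamentalRep (Fin 3)) (reg.β k)))‖ ≤ C' * Real.exp (-(δ' * (reg.a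 k * n))) := by
  obtain ⟨δ', hδ', hMD⟩ :=
    stub_decayTransfer stub_splitBound stub_crossingLaplace Nf reg m (stub_twoPoint Nf reg m hU) hM
  refine ⟨δ', hδ', ?_⟩
  rintro R R' A B ⟨f₀, q, hq, hch⟩
  obtain ⟨ι, hι, r, κ, ρ, c, hc, hcharge, hbound⟩ := stub_wickExpansion Nf R R' A B f₀ q hq hch
  choose C hC using fun i : ι => hMD (r i) R R'
  refine ⟨∑ i, c i * C i, ?_⟩
  filter_upwards [Filter.eventually_all.2 hC] with k hk S hS n hn
  exact stub_wickSum Nf ι (2 * S + 1) (reg.β k) _ _ _ c C _ hc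
    (fun i => hk i S hS n hn (κ i) (ρ i) f₀ (hcharge i)) (fun U => hbound S n _ U)

/-- **GramMoments → MinorMoments** (`ε = 2q − 1`, same constants): the landed Cauchy–Binet Gram inequality
`‖det G[I,J]‖² ≤ Re det((G Gᴴ)[I,I])` (`stub_gramInequality`) fed to the landed measure-theoretic transfer
(`stub_gramTransfer`). -/
theorem minorMoments_of_gramMoments' (Nf : ℕ) (reg : QCDRegularisation Nf) (m : Fin Nf → ℝ)
    (hG : ∃ q : ℝ, 1 / 2 < q ∧ ∀ r : ℕ, ∃ C : ℝ, ∀ᶠ k in atTop, ∀ S : ℕ, reg.L k ≤ S →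
        ∀ I : Fin r → QuarkVar Nf (2 * S + 1),
        Integrable (fun U : GaugeConfig 4 (2 * S + 1) SU3 =>
        (Matrix.of fun a b : Fin r =>
        ((diracMatrix U fun fl => reg.mcrit k + reg.a k * m fl / reg.Zm k)⁻¹ *
        ((diracMatrix U fun fl => reg.mcrit k + reg.a k * m fl / reg.Zm k)⁻¹).conjTranspose)
        (quarkEquiv (I a)) (quarkEquiv (I b))).det.re ^ q)
        (qcdLatticeMeasure (2 * S + 1) (reg.β k) fun fl => reg.mcrit k + reg.a k * m fl / reg.Zm k) ∧
        qcdPhaseQuenchedExpect (reg.β k) (2 * S + 1) (fun fl => reg.mcrit k + reg.a k * m fl / reg.Zm k)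
        (fun U : GaugeConfig 4 (2 * S + 1) SU3 =>
        (Matrix.of fun a b : Fin r =>
        ((diracMatrix U fun fl => reg.mcrit k + reg.a k * m fl / reg.Zm k)⁻¹ *
        ((diracMatrix U fun fl => reg.mcrit k + reg.a k * m fl / reg.Zm k)⁻¹).conjTranspose)
        (quarkEquiv (I a)) (quarkEquiv (I b))).det.re ^ q) ≤ C) :
    ∃ ε : ℝ, 0 < ε ∧ ∀ r : ℕ, ∃ C : ℝ, ∀ᶠ k in atTop, ∀ S : ℕ, reg.L k ≤ S →
        ∀ I J : Fin r → QuarkVar Nf (2 * S + 1),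
        Integrable (fun U : GaugeConfig 4 (2 * S + 1) SU3 =>
        ‖(Matrix.of fun a b : Fin r => (diracMatrix U fun fl => reg.mcrit k + reg.a k * m fl / reg.Zm k)⁻¹
        (quarkEquiv (I a)) (quarkEquiv (J b))).det‖ ^ (1 + ε))
        (qcdLatticeMeasure (2 * S + 1) (reg.β k) fun fl => reg.mcrit k + reg.a k * m fl / reg.Zm k) ∧
        qcdPhaseQuenchedExpect (reg.β k) (2 * S + 1) (fun fl => reg.mcrit k + reg.a k * m fl / reg.Zm k)
        (fun U : GaugeConfig 4 (2 * S + 1) SU3 =>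
        ‖(Matrix.of fun a b : Fin r => (diracMatrix U fun fl => reg.mcrit k + reg.a k * m fl / reg.Zm k)⁻¹
        (quarkEquiv (I a)) (quarkEquiv (J b))).det‖ ^ (1 + ε)) ≤ C :=
  stub_gramTransfer stub_gramInequality Nf reg m hG

/-- **UPPER ∧ GramMoments → CONC, trajectory-wise** (the two previous theorems composed). -/
theorem conc_of_upper_of_gramMoments' (Nf : ℕ) (reg : QCDRegularisation Nf) (m : Fin Nf → ℝ)
    (hU : ∃ s δ C : ℝ, 0 < s ∧ s < 1 ∧ 0 < δ ∧ ∀ᶠ k in atTop, ∀ S : ℕ, reg.L k ≤ S → ∀ (f : Fin Nf) (v : Literature.Probability.LatticeModels.Site 4), v ∈ box 4 S → (∫ U : GaugeConfig 4 (2 * S + 1) (Matrix.specialUnitaryGroup (Fin 3) ℂ), ‖(diracMatrix U fun fl => reg.mcrit k + reg.a k * m fl / reg.Zm k).det‖ * (∑ a : Fin 3, ∑ i : Fin 4, ∑ b : Fin 3, ∑ j : Fin 4, ‖(diracMatrix U fun fl => reg.mcrit k + reg.a k * m fl / reg.Zm k)⁻¹ (quarkEquiv (f, (Torus.proj (2 *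 S + 1) 0, a, i))) (quarkEquiv (f, (Torus.proj (2 * S + 1) (v), b, j)))‖) ^ s ∂(wilsonMeasure (fundamentalRep (Fin 3)) (reg.β k))) / (∫ U : GaugeConfig 4 (2 * S + 1) (Matrix.specialUnitaryGroup (Fin 3) ℂ), ‖(diracMatrix U fun fl => reg.mcrit k + reg.a k * m fl / reg.Zm k).det‖ ∂(wilsonMeasure (fundamentalRep (Fin 3)) (reg.β k))) ≤ C * Real.exp (-(δ * (reg.a k * ‖v‖))))
    (hG : ∃ q : ℝ, 1 / 2 < q ∧ ∀ r : ℕ, ∃ C : ℝ, ∀ᶠ k in atTop, ∀ S : ℕ, reg.L k ≤ S →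
        ∀ I : Fin r → QuarkVar Nf (2 * S + 1),
        Integrable (fun U : GaugeConfig 4 (2 * S + 1) SU3 =>
        (Matrix.of fun a b : Fin r =>
        ((diracMatrix U fun fl => reg.mcrit k + reg.a k * m fl / reg.Zm k)⁻¹ *
        ((diracMatrix U fun fl => reg.mcrit k + reg.a k * m fl / reg.Zm k)⁻¹).conjTranspose)
        (quarkEquiv (I a)) (quarkEquiv (I b))).det.re ^ q)
        (qcdLatticeMeasure (2 * S + 1) (reg.β k) fun fl => reg.mcrit k + reg.a k * m fl / reg.Zm k) ∧
        qcdPhaseQuenchedExpect (reg.β k) (2 * S + 1) (fun fl => reg.mcrit k + reg.a k * m fl / reg.Zm k)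
        (fun U : GaugeConfig 4 (2 * S + 1) SU3 =>
        (Matrix.of fun a b : Fin r =>
        ((diracMatrix U fun fl => reg.mcrit k + reg.a k * m fl / reg.Zm k)⁻¹ *
        ((diracMatrix U fun fl => reg.mcrit k + reg.a k * m fl / reg.Zm k)⁻¹).conjTranspose)
        (quarkEquiv (I a)) (quarkEquiv (I b))).det.re ^ q) ≤ C) :
    ∃ δ' : ℝ, 0 < δ' ∧ ∀ (R R' : ℕ) (A : QCDLatticeObservable Nf R) (B : QCDLatticeObservable Nf R'), (∃ (f₀ : Fin Nf) (q : ℤ), q ≠ 0 ∧ ∀ (θ : ℝ) (U : LGConfig 4 (Matrix.specialUnitaryGroup (Fin 3) ℂ)), ExteriorAlgebra.map (LinearMap.pi fun w => (Sum.elim (fun i => if (boxQuarkEquiv.symm i).1 = f₀ then Complex.exp (-((θ : ℂ) * Complex.I)) else 1) (fun i => if (boxQuarkEquiv.symm i).1 = f₀ then Complex.exp ((θ : ℂ) * Complex.I) else 1) (ofLex w)) • LinearMap.proj w) (A.F U) = Complex.exp (((q : ℝ) * θ : ℝ) * Complex.I) • A.F U) → ∃ C' : ℝ, ∀ᶠ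 k in atTop, ∀ S : ℕ, reg.L k ≤ S → ∀ n : ℕ, n ≤ S → ‖(∫ U : GaugeConfig 4 (2 * S + 1) (Matrix.specialUnitaryGroup (Fin 3) ℂ), (‖(diracMatrix U fun fl => reg.mcrit k + reg.a k * m fl / reg.Zm k).det‖ : ℂ) * (fermiIntegral (A.onTorus (2 * S + 1) 0 U * B.onTorus (2 * S + 1) (Pi.single 0 (n : ℤ)) U * fermiBoltzmann U fun fl => reg.mcrit k + reg.a k * m fl / reg.Zm k) / fermiIntegral (fermiBoltzmann U fun fl => reg.mcrit k + reg.a k * m fl / reg.Zm k)) ∂(wilsonMeasure (fundamentalRep (Fin 3)) (reg.β k))) / (∫ U : GaugeConfig 4 (2 * S + 1) (Matrix.specialUnitaryGroup (Fin 3) ℂ), (‖(diracMatrix U fun fl => reg.mcrit k + reg.a k * m fl / reg.Zm k).det‖ : ℂ) ∂(wilsonMeasure (fundamentalRep (Fin 3)) (reg.β k)))‖ ≤ C' * Real.exp (-(δ' * (reg.a k * n))) :=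
  conc_of_upper_of_minorMoments' Nf reg m hU (minorMoments_of_gramMoments' Nf reg m hG)

/-- **The crux from its a-priori core, minor form.**  `AprioriMinorMoments → PhaseQuenchedFlavourDecay`, where the
hypothesis (inlined; = the registered stub `stub_apriori` of line `crossing-split-integrability`) is
`∀ N_f reg m > 0, UPPER → MinorMoments`.  Closing the crux once a theorem `X` of that type lands:
`phaseQuenchedFlavourDecay_of_aprioriMinorMoments X`. -/
theorem phaseQuenchedFlavourDecay_of_aprioriMinorMoments :
    (∀ (Nf : ℕ) (reg : QCDRegularisation Nf) (m : Fin Nf → ℝ), (∀ f, 0 < m f) →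
      (∃ s δ C : ℝ, 0 < s ∧ s < 1 ∧ 0 < δ ∧ ∀ᶠ k in atTop, ∀ S : ℕ, reg.L k ≤ S → ∀ (f : Fin Nf) (v : Literature.Probability.LatticeModels.Site 4), v ∈ box 4 S → (∫ U : GaugeConfig 4 (2 * S + 1) (Matrix.specialUnitaryGroup (Fin 3) ℂ), ‖(diracMatrix U fun fl => reg.mcrit k + reg.a k * m fl / reg.Zm k).det‖ * (∑ a : Fin 3, ∑ i : Fin 4, ∑ b : Fin 3, ∑ j : Fin 4, ‖(diracMatrix U fun fl => reg.mcrit k + reg.a k * m fl / reg.Zm k)⁻¹ (quarkEquiv (f, (Torus.proj (2 * S + 1) 0, a, i))) (quarkEquiv (f, (Torus.proj (2 * S + 1) (v), b, j)))‖) ^ s ∂(wilsonMeasure (fundamentalRep (Fin 3)) (reg.β k))) / (∫ U : GaugeConfig 4 (2 * S + 1) (Matrix.specialUnitaryGroup (Fin 3) ℂ), ‖(diracMatrix U fun fl => reg.mcrit k + reg.a k * m fl / reg.Zm k).det‖ ∂(wilsonMeasure (fundamentalRep (Fin 3)) (reg.β k))) ≤ C * Real.exp (-(δ * (reg.a k *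 ‖v‖)))) →
        ∃ ε : ℝ, 0 < ε ∧ ∀ r : ℕ, ∃ C : ℝ, ∀ᶠ k in atTop, ∀ S : ℕ, reg.L k ≤ S →
        ∀ I J : Fin r → QuarkVar Nf (2 * S + 1),
        Integrable (fun U : GaugeConfig 4 (2 * S + 1) SU3 =>
        ‖(Matrix.of fun a b : Fin r => (diracMatrix U fun fl => reg.mcrit k + reg.a k * m fl / reg.Zm k)⁻¹
        (quarkEquiv (I a)) (quarkEquiv (J b))).det‖ ^ (1 + ε))
        (qcdLatticeMeasure (2 * S + 1) (reg.β k) fun fl => reg.mcrit k + reg.a k * m fl / reg.Zm k) ∧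
        qcdPhaseQuenchedExpect (reg.β k) (2 * S + 1) (fun fl => reg.mcrit k + reg.a k * m fl / reg.Zm k)
        (fun U : GaugeConfig 4 (2 * S + 1) SU3 =>
        ‖(Matrix.of fun a b : Fin r => (diracMatrix U fun fl => reg.mcrit k + reg.a k * m fl / reg.Zm k)⁻¹
        (quarkEquiv (I a)) (quarkEquiv (J b))).det‖ ^ (1 + ε)) ≤ C) →
      Summit.QuantumFields.QCD.Theses.PauliWegnerSea.PhaseQuenchedFlavourDecay :=
  fun hA Nf reg m hm hU => conc_of_upper_of_minorMoments' Nf reg m hU (hA Nf reg m hm hU)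

/-- **The crux from its a-priori core, Gram form.**  `AprioriGramMoments → PhaseQuenchedFlavourDecay`, where the
hypothesis (inlined; = the registered stub `stub_gramMomentsCore`) is `∀ N_f reg m > 0, UPPER → GramMoments` — ONE
`q > ½` and, for every `r`, a volume- and `k`-uniform bound on the phase-quenched `q`-th moments of the principal
`r × r` minors of `(Dᴴ D)⁻¹` (rows only, a positive functional of one random matrix). -/
theorem phaseQuenchedFlavourDecay_of_aprioriGramMoments :
    (∀ (Nf : ℕ) (reg : QCDRegularisation Nf) (m : Fin Nf → ℝ), (∀ f, 0 < m f) →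
      (∃ s δ C : ℝ, 0 < s ∧ s < 1 ∧ 0 < δ ∧ ∀ᶠ k in atTop, ∀ S : ℕ, reg.L k ≤ S → ∀ (f : Fin Nf) (v : Literature.Probability.LatticeModels.Site 4), v ∈ box 4 S → (∫ U : GaugeConfig 4 (2 * S + 1) (Matrix.specialUnitaryGroup (Fin 3) ℂ), ‖(diracMatrix U fun fl => reg.mcrit k + reg.a k * m fl / reg.Zm k).det‖ * (∑ a : Fin 3, ∑ i : Fin 4, ∑ b : Fin 3, ∑ j : Fin 4, ‖(diracMatrix U fun fl => reg.mcrit k + reg.a k * m fl / reg.Zm k)⁻¹ (quarkEquiv (f, (Torus.proj (2 * S + 1) 0, a, i))) (quarkEquiv (f, (Torus.proj (2 * S + 1) (v), b, j)))‖) ^ s ∂(wilsonMeasure (fundamentalRep (Fin 3)) (reg.β k))) / (∫ U : GaugeConfig 4 (2 * S + 1) (Matrix.specialUnitaryGroup (Fin 3) ℂ), ‖(diracMatrix U fun fl => reg.mcrit k + reg.a k * m fl / reg.Zm k).det‖ ∂(wilsonMeasure (fundamentalRep (Fin 3)) (reg.β k))) ≤ C * Real.exp (-(δ * (reg.a k *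 ‖v‖)))) →
        ∃ q : ℝ, 1 / 2 < q ∧ ∀ r : ℕ, ∃ C : ℝ, ∀ᶠ k in atTop, ∀ S : ℕ, reg.L k ≤ S →
        ∀ I : Fin r → QuarkVar Nf (2 * S + 1),
        Integrable (fun U : GaugeConfig 4 (2 * S + 1) SU3 =>
        (Matrix.of fun a b : Fin r =>
        ((diracMatrix U fun fl => reg.mcrit k + reg.a k * m fl / reg.Zm k)⁻¹ *
        ((diracMatrix U fun fl => reg.mcrit k + reg.a k * m fl / reg.Zm k)⁻¹).conjTranspose)
        (quarkEquiv (I a)) (quarkEquiv (I b))).det.re ^ q)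
        (qcdLatticeMeasure (2 * S + 1) (reg.β k) fun fl => reg.mcrit k + reg.a k * m fl / reg.Zm k) ∧
        qcdPhaseQuenchedExpect (reg.β k) (2 * S + 1) (fun fl => reg.mcrit k + reg.a k * m fl / reg.Zm k)
        (fun U : GaugeConfig 4 (2 * S + 1) SU3 =>
        (Matrix.of fun a b : Fin r =>
        ((diracMatrix U fun fl => reg.mcrit k + reg.a k * m fl / reg.Zm k)⁻¹ *
        ((diracMatrix U fun fl => reg.mcrit k + reg.a k * m fl / reg.Zm k)⁻¹).conjTranspose)
        (quarkEquiv (I a)) (quarkEquiv (I b))).det.re ^ q) ≤ C) →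
      Summit.QuantumFields.QCD.Theses.PauliWegnerSea.PhaseQuenchedFlavourDecay :=
  fun hA Nf reg m hm hU => conc_of_upper_of_gramMoments' Nf reg m hU (hA Nf reg m hm hU)

/-- The sibling route's byte-identical copy of the crux from the minor-form core. -/
theorem wmgPhaseQuenchedFlavourDecay_of_aprioriMinorMoments :
    (∀ (Nf : ℕ) (reg : QCDRegularisation Nf) (m : Fin Nf → ℝ), (∀ f, 0 < m f) →
      (∃ s δ C : ℝ, 0 < s ∧ s < 1 ∧ 0 < δ ∧ ∀ᶠ k in atTop, ∀ S : ℕ, reg.L k ≤ S → ∀ (f : Fin Nf) (v : Literature.Probability.LatticeModels.Site 4), v ∈ box 4 S → (∫ U : GaugeConfig 4 (2 * S + 1) (Matrix.specialUnitaryGroup (Fin 3) ℂ), ‖(diracMatrix U fun fl => reg.mcrit k + reg.a k * m fl / reg.Zm k).det‖ * (∑ a : Fin 3, ∑ i : Fin 4, ∑ b : Fin 3, ∑ j : Fin 4, ‖(diracMatrix U fun fl => reg.mcrit k + reg.a k * m fl / reg.Zm k)⁻¹ (quarkEquiv (f, (Torus.proj (2 * S + 1) 0, a, i))) (quarkEquiv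 (f, (Torus.proj (2 * S + 1) (v), b, j)))‖) ^ s ∂(wilsonMeasure (fundamentalRep (Fin 3)) (reg.β k))) / (∫ U : GaugeConfig 4 (2 * S + 1) (Matrix.specialUnitaryGroup (Fin 3) ℂ), ‖(diracMatrix U fun fl => reg.mcrit k + reg.a k * m fl / reg.Zm k).det‖ ∂(wilsonMeasure (fundamentalRep (Fin 3)) (reg.β k))) ≤ C * Real.exp (-(δ * (reg.a k * ‖v‖)))) →
        ∃ ε : ℝ, 0 < ε ∧ ∀ r : ℕ, ∃ C : ℝ, ∀ᶠ k in atTop, ∀ S : ℕ, reg.L k ≤ S →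
        ∀ I J : Fin r → QuarkVar Nf (2 * S + 1),
        Integrable (fun U : GaugeConfig 4 (2 * S + 1) SU3 =>
        ‖(Matrix.of fun a b : Fin r => (diracMatrix U fun fl => reg.mcrit k + reg.a k * m fl / reg.Zm k)⁻¹
        (quarkEquiv (I a)) (quarkEquiv (J b))).det‖ ^ (1 + ε))
        (qcdLatticeMeasure (2 * S + 1) (reg.β k) fun fl => reg.mcrit k + reg.a k * m fl / reg.Zm k) ∧
        qcdPhaseQuenchedExpect (reg.β k) (2 * S + 1) (fun fl => reg.mcrit k + reg.a k * m fl / reg.Zm k)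
        (fun U : GaugeConfig 4 (2 * S + 1) SU3 =>
        ‖(Matrix.of fun a b : Fin r => (diracMatrix U fun fl => reg.mcrit k + reg.a k * m fl / reg.Zm k)⁻¹
        (quarkEquiv (I a)) (quarkEquiv (J b))).det‖ ^ (1 + ε)) ≤ C) →
      Summit.QuantumFields.QCD.Theses.WilsonMobilityGap.PhaseQuenchedFlavourDecay :=
  fun hA Nf reg m hm hU => conc_of_upper_of_minorMoments' Nf reg m hU (hA Nf reg m hm hU)

/-- The sibling route's byte-identical copy of the crux from the Gram-form core. -/
theorem wmgPhaseQuenchedFlavourDecay_of_aprioriGramMoments :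
    (∀ (Nf : ℕ) (reg : QCDRegularisation Nf) (m : Fin Nf → ℝ), (∀ f, 0 < m f) →
      (∃ s δ C : ℝ, 0 < s ∧ s < 1 ∧ 0 < δ ∧ ∀ᶠ k in atTop, ∀ S : ℕ, reg.L k ≤ S → ∀ (f : Fin Nf) (v : Literature.Probability.LatticeModels.Site 4), v ∈ box 4 S → (∫ U : GaugeConfig 4 (2 * S + 1) (Matrix.specialUnitaryGroup (Fin 3) ℂ), ‖(diracMatrix U fun fl => reg.mcrit k + reg.a k * m fl / reg.Zm k).det‖ * (∑ a : Fin 3, ∑ i : Fin 4, ∑ b : Fin 3, ∑ j : Fin 4, ‖(diracMatrix U fun fl => reg.mcrit k + reg.a k * m fl / reg.Zm k)⁻¹ (quarkEquiv (f, (Torus.proj (2 * S + 1) 0, a, i))) (quarkEquiv (f, (Torus.proj (2 * S + 1) (v), b, j)))‖) ^ s ∂(wilsonMeasure (fundamentalRep (Fin 3)) (reg.β k))) / (∫ U : GaugeConfig 4 (2 * S + 1) (Matrix.specialUnitaryGroup (Fin 3) ℂ), ‖(diracMatrix U fun fl => reg.mcrit k + reg.a k * m fl / reg.Zm k).det‖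 ∂(wilsonMeasure (fundamentalRep (Fin 3)) (reg.β k))) ≤ C * Real.exp (-(δ * (reg.a k * ‖v‖)))) →
        ∃ q : ℝ, 1 / 2 < q ∧ ∀ r : ℕ, ∃ C : ℝ, ∀ᶠ k in atTop, ∀ S : ℕ, reg.L k ≤ S →
        ∀ I : Fin r → QuarkVar Nf (2 * S + 1),
        Integrable (fun U : GaugeConfig 4 (2 * S + 1) SU3 =>
        (Matrix.of fun a b : Fin r =>
        ((diracMatrix U fun fl => reg.mcrit k + reg.a k * m fl / reg.Zm k)⁻¹ *
        ((diracMatrix U fun fl => reg.mcrit k + reg.a k * m fl / reg.Zm k)⁻¹).conjTranspose)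
        (quarkEquiv (I a)) (quarkEquiv (I b))).det.re ^ q)
        (qcdLatticeMeasure (2 * S + 1) (reg.β k) fun fl => reg.mcrit k + reg.a k * m fl / reg.Zm k) ∧
        qcdPhaseQuenchedExpect (reg.β k) (2 * S + 1) (fun fl => reg.mcrit k + reg.a k * m fl / reg.Zm k)
        (fun U : GaugeConfig 4 (2 * S + 1) SU3 =>
        (Matrix.of fun a b : Fin r =>
        ((diracMatrix U fun fl => reg.mcrit k + reg.a k * m fl / reg.Zm k)⁻¹ *
        ((diracMatrix U fun fl => reg.mcrit k + reg.a k * m fl / reg.Zm k)⁻¹).conjTranspose)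
        (quarkEquiv (I a)) (quarkEquiv (I b))).det.re ^ q) ≤ C) →
      Summit.QuantumFields.QCD.Theses.WilsonMobilityGap.PhaseQuenchedFlavourDecay :=
  fun hA Nf reg m hm hU => conc_of_upper_of_gramMoments' Nf reg m hU (hA Nf reg m hm hU)

end Summit.QuantumFields.QCD.Cruxes.PhaseQuenchedFlavourDecay.CrossingSplitIntegrability

end
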